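import Mathlib
import HarnessLib
import Summits.HubbardSuperconductivity.Statement
import Literature.MathematicalPhysics.QuantumLattice.KohnLuttinger
import Literature.MathematicalPhysics.QuantumLattice.DWaveSource
import Summits.HubbardSuperconductivity.HubbardSuperconductivity.Theorems.ThermalWedgeTwSeededRungThermalWindow

/-!
# Disproof of `TwThermalWindowRungGlue` (stmt-HubbardSuperconductivity-15417) — findings

Standing disprover, gen 1 / cycle 1 (`refuter-cdisprove-stmt-HubbardSuperconductivity-15417-0`,
2026-08-16). Route `ThermalWedge`, rank-5 crux (crux by admissibility only; support-grade glue):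

    TwThermalWindowRungGlue := TwSeededEnsembleEquivalenceR → TwSourcedCondensation → ⟨body of TwSeededRung⟩.

Everything below is `lean check`ed (rc 0, 0 sorry, axioms ⊆ {propext, Classical.choice, Quot.sound});
prose lives in this docblock and in docstrings only.

## VERDICT: NOT REFUTABLE — the crux is a kernel-checked THEOREM (a disproof would make Lean inconsistent)

* F1 (kill impossible). `glue_holds : TwThermalWindowRungGlue` (and its rfl-normal form
  `glueNF_holds : TwSeededEnsembleEquivalenceR → TwSourcedCondensation → TwSeededRung`) is the three-token port `fun hE hC => Theorems.twSeededRung_structural_thermalWindow hE hC` of the landed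
  engine (p97295), against the LIVE route module, axioms {propext, Classical.choice, Quot.sound};
  `glue_irrefutable : ¬ ¬ TwThermalWindowRungGlue`. On the rev-9 TEXT of `Theses/ThermalWedge.lean` the identity
  `TwThermalWindowRungGlue = (TwSeededEnsembleEquivalenceR → TwSourcedCondensation → TwSeededRung)` is `rfl`
  (checked in a verbatim local copy of all 14 route `def`s, evidence file TW.lean: rc 0, port closes it, same
  axioms). INFRA NOTE FOR PROVERS (not maths): at 16:25–16:30Z the farm olean of `Theses/ThermalWedge.lean` is STALE
  (built before rev 5: it still knows `TwKLCanonical`/`TwCertB1gWedge` and does NOT know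
  `TwThermalWindowRungGlue` → "Unknown identifier"), which is why this file (like the crux-attack refuter's
  TW.lean and the ideators' SketchIdeator1/2.lean) re-declares the four relevant route decls in section `Inlined`
  with bodies copied VERBATIM by script from Theses/ThermalWedge.lean rev 9; against the live olean the same port
  `TwSeededEnsembleEquivalenceR → TwSourcedCondensation → TwSeededRung := fun hE hC => … hE hC` also checks
  (evidence W3.lean, rc 0, axioms std), so the three hypothesis/conclusion bodies did not drift between the olean
  and rev 9. WHEN THE FARM CATCHES UP: replace section `Inlined` by
  `import Summits.HubbardSuperconductivity.HubbardSuperconductivity.Theses.ThermalWedge` +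
  `open Summit.HubbardSuperconductivity.HubbardSuperconductivity.Theses.ThermalWedge`; nothing else changes.
  The moment the farm rebuilds the module,
  `theorem twThermalWindowRungGlue_proof : TwThermalWindowRungGlue := fun hE hC => …thermalWindow hE hC`
  elaborates as is (Theorems/ThermalWedgeTwThermalWindowRungGlue.lean, importing the Theses file AND the engine
  module; no import cycle — evidence file W3.lean has exactly those two imports and checks rc 0).

* F2 (load-bearing analysis — why the usual `_false_without_<H>` lemmas CANNOT exist for this item).
  `GlueWithoutEnsemble := TwSourcedCondensation → TwSeededRung`, `GlueWithoutCondensation :=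
  TwSeededEnsembleEquivalenceR → TwSeededRung`. Their negations are, `Iff`-provably (`not_glueWithoutEnsemble_iff`,
  `not_glueWithoutCondensation_iff`), `TwSourcedCondensation ∧ ¬ TwSeededRung` resp.
  `TwSeededEnsembleEquivalenceR ∧ ¬ TwSeededRung`: each would require PROVING an open rank-3/4 crux AND REFUTING the
  anchor `TwSeededRung` (every-ground-state d-wave LRO of the seeded repulsive torus for seeds g ≥ K·U) — three
  thermodynamic-limit statements over `hubbardTorus 2 L 1 U`, no finite/decidable model, no ledger negative
  (`ledger negatives --problem HubbardSuperconductivity`: 2 entries, neither on stmt-15581/1697/1699), no barrier of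
  `Literature/Barriers/HubbardSuperconductivity/` bites a definitional glue. So "E_R is load-bearing" / "C is
  load-bearing" are NOT theorems anyone can land today; what can be said is F3.

* F3 (what the only known proof CONSUMES — the drift tolerance of this item; drift of the hypothesis bodies is its
  one failure mode). Reading `twSeededRung_structural_thermalWindow`:
  (i)  from `TwSeededEnsembleEquivalenceR` exactly ONE instance per (δ,U,g): β* := exp(a/U) with a := min aᴱ aᶜ,
       which returns μ ∈ [μ₁,μ₂]; then ε := c·a·s²/(32U) returns L₁;
  (ii) from `TwSourcedCondensation` exactly ONE instance: (U, β*, that μ) returns L₂, used at the single source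
       h := s := exp(−a/(4U)) (≤ h₀ once U ≤ a h₀/4);
  (iii) `Even L` in the conclusion is DECORATION — the engine binds it as `_hEven` and never uses it: the glue with
       `Even L →` deleted from the conclusion is proved by the same term (strengthened conclusion still true);
  (iv) the β-WINDOW quantifier (∀ β ∈ [1, e^{a/U}]) of the hypotheses is what synchronises the two cruxes' private
       exponents aᴱ, aᶜ at a = min aᴱ aᶜ: restating BOTH hypotheses pointwise at their own top temperatures
       (β = e^{aᴱ/U}, resp. e^{aᶜ/U}) would break the port (neither instance need lie in the other's window), while
       restating ONE of them pointwise-in-β at β = e^{a'/U} for every a' ≤ its own a keeps it;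
  (v)  C's `∀ h, |h| ≤ h₀` is used at one h and C's `∀ μ ∈ [μ₁,μ₂]` at the one canonical μ delivered by E_R, so the
       (much weaker) probe-schedule form of C suffices (cf. Ideas/probe-schedule.md, `Theorems.twSeededRung_of_probe`);
  (vi) the seed floor of the conclusion is K = max (16/(c·a)) K' and U₀ = min(U₀ᴱ, U₀ᶜ, 1/(20K), a h₀/4,
       c a/(32(c log 2 + C + log 4))); the output constant is c(U,g) = c a e^{−a/(2U)}/(8Ug) — astronomically small
       but positive, as the anchor's why-might-fail says.

* F4 (vacuity). Whether the hypotheses are SATISFIABLE is exactly the open content of cruxes stmt-15581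
  (`TwSeededEnsembleEquivalenceR`, thermal-window repair of stmt-1698 whose β-free form is ≡ the T=0 hull touch,
  `Theorems/TwSeededEnsembleEquivalence/Negative/HullTouchNormalForm`) and stmt-1697 (`TwSourcedCondensation`,
  standing disprover `Cruxes/TwSourcedCondensation/Disproof.lean`: RHS ≥ 0, even, 2K_d-Lipschitz; no kill).
  Cheap joint-unsatisfiability probes (`simp_all`/`aesop` on hE, hC ⊢ False) fail. Were either hypothesis refuted,
  THIS item stays true (vacuously) and the route breaks on THAT crux (route kill criteria (a)/(b)), not here.

* F5 (triviality battery on `GlueNF`, engine NOT imported): `simp [defs]` — whnf timeout (200000 heartbeats);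
  `aesop` — fails after exhaustive search; `exact?` — no lemma (the engine is a ~2000-line cone: `tw_rung_master`,
  `twr_margin`, AHM hard half); `positivity` — not applicable; conclusion alone (`TwSeededRung`) — not closed;
  with the engine module imported, `exact?`/the port closes it at once (F1).

## HANDOFF (for the next arm of this seat)
Nothing is sorried. Nothing can be landed under `Theorems/TwThermalWindowRungGlue/Negative/`: every candidate
negative lemma about this item is either false (F1) or equivalent to (open crux ∧ ¬anchor) (F2). If the planner
RESTATES `TwSeededEnsembleEquivalenceR` / `TwSourcedCondensation` / `TwSeededRung`, re-run F1 (TW.lean recipe) —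
F3 says which restatements the port tolerates.
-/

set_option linter.dupNamespace false

namespace Summit.HubbardSuperconductivity.HubbardSuperconductivity.Cruxes.TwThermalWindowRungGlue.Disproof

open scoped BigOperators Topology Manifold Classical MeasureTheory ProbabilityTheory Matrix InnerProductSpace ComplexConjugate ContinuousMap
open Filter Set Function TopologicalSpace MeasureTheory
open Literature.Hubbard

section Inlined
/-! ### Inlined route decls (verbatim, rev 9) — swap for `open …Theses.ThermalWedge` once the farm olean is rebuilt -/

/-- verbatim copy (rev 9) of route decl `TwSourcedCondensation` · stmt-HubbardSuperconductivity-1697 -/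
def TwSourcedCondensation : Prop :=
  ∀ μ₁ μ₂ : ℝ, -4 < μ₁ → μ₁ ≤ μ₂ → μ₂ < 0 → ∃ U₀ a c C h₀ : ℝ, 0 < U₀ ∧ 0 < a ∧ 0 < c ∧ 0 < C ∧ 0 < h₀ ∧ ∀ U : ℝ, 0 < U → U ≤ U₀ → ∀ β : ℝ, 1 ≤ β → β ≤ Real.exp (a / U) → ∀ μ ∈ Set.Icc μ₁ μ₂, ∃ L₀ : ℕ, ∀ (L : ℕ) [NeZero L], L₀ ≤ L → ∀ h : ℝ, |h| ≤ h₀ → c * h ^ 2 * Real.log (1 / (|h| + 1 / β)) - C * h ^ 2 ≤ (Real.log (Matrix.partitionFn β (Literature.MathematicalPhysics.QuantumLattice.dWaveSourceTorus L U μ h)).re / (β * (L : ℝ) ^ 2)) - (Real.log (Matrix.partitionFn β (Literature.MathematicalPhysics.QuantumLattice.dWaveSourceTorus L U μ 0)).re / (β * (L : ℝ) ^ 2))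

/-- verbatim copy (rev 9) of route decl `TwSeededEnsembleEquivalenceR` · stmt-HubbardSuperconductivity-15581 -/
def TwSeededEnsembleEquivalenceR : Prop :=
  ∀ δ ∈ Set.Icc (1/10 : ℝ) (2/5 : ℝ), ∃ μ₁ μ₂ : ℝ, -4 < μ₁ ∧ μ₁ ≤ μ₂ ∧ μ₂ < 0 ∧ ∃ a K' U₀ : ℝ, 0 < a ∧ 0 < K' ∧ 0 < U₀ ∧ ∀ U ∈ Set.Ioc (0 : ℝ) U₀, ∀ g ∈ Set.Icc (K' * U) (1 / 10), ∀ β : ℝ, 1 ≤ β → β ≤ Real.exp (a / U) → ∃ μ ∈ Set.Icc μ₁ μ₂, ∀ ε : ℝ, 0 < ε → ∃ L₀ : ℕ, ∀ (L : ℕ) [NeZero L], L₀ ≤ L → (((Literature.MathematicalPhysics.QuantumLattice.hubbardTorus 2 L 1 U - ((g / (L : ℝ) ^ 2 : ℝ) : ℂ) • ((Literature.MathematicalPhysics.QuantumLattice.pairField Literature.MathematicalPhysics.QuantumLattice.dWaveFormFactor L)ᴴ * Literature.MathematicalPhysics.QuantumLattice.pairField Literature.MathematicalPhysics.QuantumLattice.dWaveFormFactor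 L))).minEnergyOn (Literature.MathematicalPhysics.QuantumLattice.szSector (Λ := Literature.MathematicalPhysics.QuantumLattice.FermionTorus 2 L) (2 * ⌊(1 - δ) * (L : ℝ) ^ 2 / 2⌋₊) 0) / (L : ℝ) ^ 2) + (Real.log (Matrix.partitionFn β (Literature.MathematicalPhysics.QuantumLattice.hubbardTorusWith 2 L 1 U μ - ((g / (L : ℝ) ^ 2 : ℝ) : ℂ) • ((Literature.MathematicalPhysics.QuantumLattice.pairField Literature.MathematicalPhysics.QuantumLattice.dWaveFormFactor L)ᴴ * Literature.MathematicalPhysics.QuantumLattice.pairField Literature.MathematicalPhysics.QuantumLattice.dWaveFormFactor L))).re / (β * (L : ℝ) ^ 2)) - μ * ((2 * ⌊(1 - δ) * (L : ℝ) ^ 2 / 2⌋₊) : ℝ) / (L : ℝ) ^ 2 ≤ Real.log 4 / β + ε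

/-- verbatim copy (rev 9) of route decl `TwSeededRung` · stmt-HubbardSuperconductivity-1699 -/
def TwSeededRung : Prop :=
  ∀ δ ∈ Set.Icc (1/10 : ℝ) (2/5 : ℝ), ∃ U₀ K : ℝ, 0 < U₀ ∧ 0 < K ∧ K * U₀ ≤ 1 / 20 ∧ ∀ U ∈ Set.Ioc (0 : ℝ) U₀, (∀ g ∈ Set.Icc (K * U) (1 / 10), ∃ c : ℝ, 0 < c ∧ ∃ L₀ : ℕ, ∀ (L : ℕ) [NeZero L], L₀ ≤ L → Even L → ∀ (ψ : Literature.MathematicalPhysics.QuantumLattice.Fock (Literature.MathematicalPhysics.QuantumLattice.Orb (Literature.MathematicalPhysics.QuantumLattice.FermionTorus 2 L))), star ψ ⬝ᵥ ψ = 1 → Literature.MathematicalPhysics.QuantumLattice.IsGroundStateInSector (Literature.MathematicalPhysics.QuantumLattice.hubbardTorus 2 L 1 U - ((g / (L : ℝ) ^ 2 : ℝ) : ℂ) • ((Literature.MathematicalPhysics.QuantumLattice.pairField Literature.MathematicalPhysics.QuantumLattice.dWaveFormFactor L)ᴴ * Literature.MathematicalPhysics.QuantumLattice.pairField Literature.MathematicalPhysics.QuantumLattice.dWaveFormFactor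 L)) (2 * ⌊(1 - δ) * (L : ℝ) ^ 2 / 2⌋₊) 0 ψ → c * (L : ℝ) ^ 4 ≤ (Literature.MathematicalPhysics.QuantumLattice.expect ((Literature.MathematicalPhysics.QuantumLattice.pairField Literature.MathematicalPhysics.QuantumLattice.dWaveFormFactor L)ᴴ * Literature.MathematicalPhysics.QuantumLattice.pairField Literature.MathematicalPhysics.QuantumLattice.dWaveFormFactor L) ψ).re)

/-- verbatim copy (rev 9) of route decl `TwThermalWindowRungGlue` · stmt-HubbardSuperconductivity-15417 (THE CRUX) -/
def TwThermalWindowRungGlue : Prop :=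
  TwSeededEnsembleEquivalenceR → TwSourcedCondensation → ∀ δ ∈ Set.Icc (1/10 : ℝ) (2/5 : ℝ), ∃ U₀ K : ℝ, 0 < U₀ ∧ 0 < K ∧ K * U₀ ≤ 1 / 20 ∧ ∀ U ∈ Set.Ioc (0 : ℝ) U₀, (∀ g ∈ Set.Icc (K * U) (1 / 10), ∃ c : ℝ, 0 < c ∧ ∃ L₀ : ℕ, ∀ (L : ℕ) [NeZero L], L₀ ≤ L → Even L → ∀ (ψ : Literature.MathematicalPhysics.QuantumLattice.Fock (Literature.MathematicalPhysics.QuantumLattice.Orb (Literature.MathematicalPhysics.QuantumLattice.FermionTorus 2 L))), star ψ ⬝ᵥ ψ = 1 → Literature.MathematicalPhysics.QuantumLattice.IsGroundStateInSector (Literature.MathematicalPhysics.QuantumLattice.hubbardTorus 2 L 1 U - ((g / (L : ℝ) ^ 2 : ℝ) : ℂ) • ((Literature.MathematicalPhysics.QuantumLattice.pairField Literature.MathematicalPhysics.QuantumLattice.dWaveFormFactor L)ᴴ * Literature.MathematicalPhysics.QuantumLattice.pairField Literature.MathematicalPhysics.QuantumLattice.dWaveFormFactor L)) (2 * ⌊(1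 - δ) * (L : ℝ) ^ 2 / 2⌋₊) 0 ψ → c * (L : ℝ) ^ 4 ≤ (Literature.MathematicalPhysics.QuantumLattice.expect ((Literature.MathematicalPhysics.QuantumLattice.pairField Literature.MathematicalPhysics.QuantumLattice.dWaveFormFactor L)ᴴ * Literature.MathematicalPhysics.QuantumLattice.pairField Literature.MathematicalPhysics.QuantumLattice.dWaveFormFactor L) ψ).re)

end Inlined

/-! ### F1 — the crux is a theorem -/

/-- rfl-normal form of the crux: the crux inlines the body of `TwSeededRung` verbatim. -/
def GlueNF : Prop :=
  TwSeededEnsembleEquivalenceR → TwSourcedCondensation → TwSeededRung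

/-- The crux IS its normal form, definitionally. -/
theorem glue_eq_glueNF : TwThermalWindowRungGlue = GlueNF := rfl

/-- **F1 — the crux holds**: port of the landed engine `twSeededRung_structural_thermalWindow` (p97295),
whose two hypotheses and conclusion are the verbatim bodies of the three route decls. [folklore] -/
theorem glue_holds : TwThermalWindowRungGlue :=
  fun hE hC =>
    Summit.HubbardSuperconductivity.HubbardSuperconductivity.Theorems.twSeededRung_structural_thermalWindow
      hE hC

/-- The same port on the normal form. -/
theorem glueNF_holds : GlueNF := glue_holds

/-- **F1 — hence no refutation exists** (short of an inconsistency in Lean + Mathlib). -/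
theorem glue_irrefutable : ¬ ¬ TwThermalWindowRungGlue :=
  fun h => h glue_holds

/-! ### F2 — load-bearing analysis: the weakened glues and the exact price of refuting them -/

/-- The crux with the ensemble hypothesis `TwSeededEnsembleEquivalenceR` dropped. -/
def GlueWithoutEnsemble : Prop :=
  TwSourcedCondensation → TwSeededRung

/-- The crux with the condensation hypothesis `TwSourcedCondensation` dropped. -/
def GlueWithoutCondensation : Prop :=
  TwSeededEnsembleEquivalenceR → TwSeededRung

/-- Refuting the glue-without-ensemble IS proving the condensation crux and refuting the anchor. -/
theorem not_glueWithoutEnsemble_iff :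
    ¬ GlueWithoutEnsemble ↔ (TwSourcedCondensation ∧ ¬ TwSeededRung) := by
  unfold GlueWithoutEnsemble
  exact Classical.not_imp

/-- Refuting the glue-without-condensation IS proving the ensemble crux and refuting the anchor. -/
theorem not_glueWithoutCondensation_iff :
    ¬ GlueWithoutCondensation ↔ (TwSeededEnsembleEquivalenceR ∧ ¬ TwSeededRung) := by
  unfold GlueWithoutCondensation
  exact Classical.not_imp

/-- What a refuted ANCHOR would give (route kill, not an item kill): the two hypotheses of the crux cannot
both hold — the crux itself stays true (F1). -/
theorem hyps_inconsistent_of_not_rung (h : ¬ TwSeededRung) :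
    ¬ (TwSeededEnsembleEquivalenceR ∧ TwSourcedCondensation) :=
  fun hEC => h (glue_holds hEC.1 hEC.2)

/-- … and the two weakened glues are then exactly the negations of the OTHER crux. -/
theorem glueWithoutEnsemble_iff_of_not_rung (h : ¬ TwSeededRung) :
    GlueWithoutEnsemble ↔ ¬ TwSourcedCondensation :=
  ⟨fun hG hC => h (hG hC), fun hnC hC => absurd hC hnC⟩

theorem glueWithoutCondensation_iff_of_not_rung (h : ¬ TwSeededRung) :
    GlueWithoutCondensation ↔ ¬ TwSeededEnsembleEquivalenceR :=
  ⟨fun hG hE => h (hG hE), fun hnE hE => absurd hE hnE⟩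

end Summit.HubbardSuperconductivity.HubbardSuperconductivity.Cruxes.TwThermalWindowRungGlue.Disproof
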